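import Mathlib

/-!
# Infinity types in the group ring `ℤ[G]`: CM types, reflex types, and the character of `⋀ⁿ H¹`

Blind re-derivation cell `pub-hodge-repro`, seat `typer-2`.  Mathlib only.

## Setting (the finite-group model shared with `CMType.lean`)

`K` is a CM field, Galois over `ℚ` with group `G`; `c ∈ G` is complex conjugation (a central
involution); a CM type is a subset `Φ ⊆ G` containing exactly one element of each pair `{g, c * g}`.
Fixing one embedding `K ↪ ℂ` identifies `Hom(K, ℂ)` with `G`, and `Aut(ℂ)` acts on `Hom(K, ℂ)`
through `G` by LEFT multiplication.

The character group of the torus `T_K = Res_{K/ℚ} 𝔾_m` is the free abelian group on `Hom(K, ℂ)`,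
i.e. `ℤ[G]`; we use Mathlib's `MonoidAlgebra ℤ G`, so that the Galois action is left multiplication by
`single g 1` and the group-ring product is available.  Infinity types of algebraic Hecke characters of
`K` are elements of `ℤ[G]`: if `ψ` has infinity type `x`, then `σ ∘ ψ` has infinity type `[σ] * x`, and
the infinity type of a product of characters is the sum.

## Contents

* `typeOf S = ∑_{g ∈ S} [g]`, `reflexOf S = ∑_{g ∈ S} [g⁻¹]`, `normElt = ∑_{g ∈ G} [g]`;
* `typeOf (g • S) = [g] * typeOf S` (Galois translate = left multiplication) and
  `reflexOf (g • S) = reflexOf S * [g⁻¹]`;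
* the *wedge identity* `(typeOf Δ * reflexOf Φ).coeff g = |Δ ∩ g • Φ|`, hence
  `typeOf Δ * reflexOf Φ = p • normElt ↔ ∀ g, |Δ ∩ g • Φ| = p`;
* the reflex stabiliser `reflexStab Φ = Stab_G(Φ)` (the subgroup cutting out the reflex field) and the
  right-`reflexStab`-invariance of `reflexOf Φ` (so `reflexOf Φ` is a function on `G / Stab`, i.e. an
  element of `ℤ[Hom(K*, ℂ)]`).

Interpretation (for the provers; not used in any proof here): for the abelian variety `A` of CM type
`(K, Φ)`, the Hecke character `ψ` attached to `A` over the reflex field has infinity type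
`reflexOf Φ` (the reflex norm), the `e_δ`-component of `H¹` has character `δ ∘ ψ` of infinity type
`[δ] * reflexOf Φ`, and the basis vector `⟨Δ⟩ = ⋀_{δ ∈ Δ} e_δ` of `⋀^{|Δ|} H¹` has character
`∏_{δ ∈ Δ} δ ∘ ψ` of infinity type `typeOf Δ * reflexOf Φ`.  The wedge identity says this is
`p · (infinity type of the norm)` exactly when `|Δ ∩ g Φ| = p` for every `g ∈ G`, i.e. exactly under
Pohlmann's Hodge condition for `⟨Δ⟩` (see `CMType.lean`, `isHodgeSet_iff_two_mul`).
-/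

open Finset MonoidAlgebra
open scoped Pointwise

namespace HodgeRepro.Hecke

variable {G : Type*} [Group G] [DecidableEq G]

/-- `typeOf S = ∑_{g ∈ S} [g] ∈ ℤ[G]`: the infinity type attached to a subset `S ⊆ G` (for a CM type
`Φ` this is the "CM type as a character", for `Δ` the character of the basis vector `⟨Δ⟩`). -/
noncomputable def typeOf (S : Finset G) : MonoidAlgebra ℤ G := ∑ g ∈ S, single g 1

/-- `reflexOf S = ∑_{g ∈ S} [g⁻¹] ∈ ℤ[G]`: the reflex element of `S` (for a CM type `Φ` this is the
infinity type of the reflex norm `N_{Φ*}`). -/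
noncomputable def reflexOf (S : Finset G) : MonoidAlgebra ℤ G := ∑ g ∈ S, single g⁻¹ 1

/-- `normElt = ∑_{g ∈ G} [g]`: the infinity type of the norm character `N_{K/ℚ}`. -/
noncomputable def normElt [Fintype G] : MonoidAlgebra ℤ G := ∑ g : G, single g 1

/-! ### Coefficients -/

omit [Group G] in
/-- The `g`-coefficient of `typeOf S` is `1` iff `g ∈ S`. -/
@[simp] theorem coeff_typeOf (S : Finset G) (g : G) :
    (typeOf S).coeff g = if g ∈ S then 1 else 0 := by
  unfold typeOf
  simp [Finsupp.single_apply]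

/-- The `g`-coefficient of `reflexOf S` is `1` iff `g⁻¹ ∈ S`. -/
@[simp] theorem coeff_reflexOf (S : Finset G) (g : G) :
    (reflexOf S).coeff g = if g⁻¹ ∈ S then 1 else 0 := by
  unfold reflexOf
  simp only [coeff_sum, Finsupp.finsetSum_apply, coeff_single, Finsupp.single_apply]
  have : ∀ s : G, (s⁻¹ = g) ↔ (s = g⁻¹) := fun s => inv_eq_iff_eq_inv
  simp only [this]
  exact Finset.sum_ite_eq' S g⁻¹ (fun _ => (1 : ℤ))

omit [Group G] in
/-- Every coefficient of the norm element is `1`. -/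
@[simp] theorem coeff_normElt [Fintype G] (g : G) : (normElt : MonoidAlgebra ℤ G).coeff g = 1 := by
  unfold normElt
  simp [Finsupp.single_apply]

omit [Group G] [DecidableEq G] in
/-- Two elements of `ℤ[G]` with the same coefficients are equal. -/
theorem ext_coeff {x y : MonoidAlgebra ℤ G} (h : ∀ g, x.coeff g = y.coeff g) : x = y :=
  coeff_injective (Finsupp.ext h)

/-! ### Basic algebra -/

omit [DecidableEq G] in
/-- `typeOf ∅ = 0`. -/
theorem typeOf_empty : typeOf (∅ : Finset G) = 0 := by simp [typeOf]

omit [Group G] [DecidableEq G] in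
/-- `typeOf {g} = [g]`. -/
theorem typeOf_singleton (g : G) : typeOf ({g} : Finset G) = single g 1 := by simp [typeOf]

/-- `typeOf` is additive on disjoint unions. -/
theorem typeOf_union_of_disjoint {S T : Finset G} (h : Disjoint S T) :
    typeOf (S ∪ T) = typeOf S + typeOf T := by
  unfold typeOf
  exact Finset.sum_union h

omit [Group G] [DecidableEq G] in
/-- `typeOf G = normElt`. -/
theorem typeOf_univ [Fintype G] : typeOf (univ : Finset G) = normElt := rfl

/-- `typeOf S + typeOf Sᶜ = normElt`. -/
theorem typeOf_add_typeOf_compl [Fintype G] (S : Finset G) : typeOf S + typeOf Sᶜ = normElt := by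
  rw [← typeOf_union_of_disjoint disjoint_compl_right, union_compl, typeOf_univ]

/-- `reflexOf S = typeOf S⁻¹`. -/
theorem reflexOf_eq_typeOf_image (S : Finset G) : reflexOf S = typeOf (S.image (·⁻¹)) := by
  unfold reflexOf typeOf
  rw [Finset.sum_image]
  intro x _ y _ hxy
  exact inv_injective hxy

/-- `reflexOf` is additive on disjoint unions. -/
theorem reflexOf_union_of_disjoint {S T : Finset G} (h : Disjoint S T) :
    reflexOf (S ∪ T) = reflexOf S + reflexOf T := by
  unfold reflexOf
  exact Finset.sum_union h

/-- `reflexOf G = normElt`. -/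
theorem reflexOf_univ [Fintype G] : reflexOf (univ : Finset G) = normElt := by
  apply ext_coeff
  intro g
  simp

/-- `reflexOf S + reflexOf Sᶜ = normElt`. -/
theorem reflexOf_add_reflexOf_compl [Fintype G] (S : Finset G) :
    reflexOf S + reflexOf Sᶜ = normElt := by
  rw [← reflexOf_union_of_disjoint disjoint_compl_right, union_compl, reflexOf_univ]

/-! ### The Galois action is left multiplication -/

/-- The Galois translate `g • S` has infinity type `[g] * typeOf S`. -/
theorem typeOf_smul (g : G) (S : Finset G) : typeOf (g • S) = single g 1 * typeOf S := by
  unfold typeOf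
  rw [Finset.mul_sum, smul_finset_def, Finset.sum_image]
  · simp only [single_mul_single, mul_one, smul_eq_mul]
  · intro x _ y _ hxy
    exact smul_left_cancel g hxy

/-- The reflex element of a Galois translate: `reflexOf (g • S) = reflexOf S * [g⁻¹]`. -/
theorem reflexOf_smul (g : G) (S : Finset G) : reflexOf (g • S) = reflexOf S * single g⁻¹ 1 := by
  unfold reflexOf
  rw [Finset.sum_mul, smul_finset_def, Finset.sum_image]
  · simp only [single_mul_single, mul_one, smul_eq_mul, _root_.mul_inv_rev]
  · intro x _ y _ hxy
    exact smul_left_cancel g hxy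

/-- The norm element is fixed by the Galois action. -/
theorem single_mul_normElt [Fintype G] (g : G) : single g 1 * normElt = normElt := by
  apply ext_coeff
  intro h
  rw [coeff_single_mul_apply, coeff_normElt, coeff_normElt, one_mul]

/-! ### The wedge identity -/

/-- **Wedge identity.** The `g`-coefficient of `typeOf Δ * reflexOf Φ` is `|Δ ∩ g • Φ|`. -/
theorem coeff_typeOf_mul_reflexOf (Δ Φ : Finset G) (g : G) :
    (typeOf Δ * reflexOf Φ).coeff g = ((Δ ∩ g • Φ).card : ℤ) := by
  unfold typeOf reflexOf
  rw [Finset.sum_mul_sum]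
  simp only [single_mul_single, mul_one, coeff_sum, Finsupp.finsetSum_apply, coeff_single,
    Finsupp.single_apply]
  have h1 : ∀ d ∈ Δ, (∑ s ∈ Φ, if d * s⁻¹ = g then (1 : ℤ) else 0) =
      if g⁻¹ * d ∈ Φ then 1 else 0 := by
    intro d _
    have : ∀ s : G, (d * s⁻¹ = g) ↔ (s = g⁻¹ * d) := by
      intro s
      rw [mul_inv_eq_iff_eq_mul, eq_comm, eq_inv_mul_iff_mul_eq, eq_comm]
    simp only [this]
    exact Finset.sum_ite_eq' Φ (g⁻¹ * d) (fun _ => (1 : ℤ))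
  rw [Finset.sum_congr rfl h1, Finset.sum_boole]
  congr 2
  ext d
  simp only [mem_filter, mem_inter, ← inv_smul_mem_iff, smul_eq_mul]

/-- The wedge character is `p` times the norm iff every Galois translate of `Φ` meets `Δ` in exactly
`p` elements (Pohlmann's condition in pairing form, see `CMType.lean`). -/
theorem typeOf_mul_reflexOf_eq_iff [Fintype G] (Δ Φ : Finset G) (p : ℕ) :
    typeOf Δ * reflexOf Φ = (p : ℤ) • normElt ↔ ∀ g : G, (Δ ∩ g • Φ).card = p := by
  constructor
  · intro h g
    have := congrArg (fun x : MonoidAlgebra ℤ G => x.coeff g) h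
    simp only [coeff_typeOf_mul_reflexOf, coeff_smul, Finsupp.smul_apply, coeff_normElt,
      smul_eq_mul, mul_one] at this
    exact_mod_cast this
  · intro h
    apply ext_coeff
    intro g
    simp only [coeff_typeOf_mul_reflexOf, coeff_smul, Finsupp.smul_apply, coeff_normElt,
      smul_eq_mul, mul_one, h g]

/-- The total mass of the wedge character: `∑_g |Δ ∩ g • Φ| = |Δ| · |Φ|`. -/
theorem sum_card_inter_smul [Fintype G] (Δ Φ : Finset G) :
    ∑ g : G, (Δ ∩ g • Φ).card = Δ.card * Φ.card := by
  calc ∑ g : G, (Δ ∩ g • Φ).card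
      = ∑ g : G, ∑ d ∈ Δ, (if g⁻¹ * d ∈ Φ then 1 else 0) := by
        refine Finset.sum_congr rfl fun g _ => ?_
        rw [Finset.sum_boole, Nat.cast_id]
        congr 1
        ext d
        simp only [mem_filter, mem_inter, ← inv_smul_mem_iff, smul_eq_mul]
    _ = ∑ d ∈ Δ, ∑ g : G, (if g⁻¹ * d ∈ Φ then 1 else 0) := Finset.sum_comm
    _ = ∑ d ∈ Δ, Φ.card := by
        refine Finset.sum_congr rfl fun d _ => ?_
        rw [Finset.sum_boole, Nat.cast_id]
        have : (univ.filter fun g : G => g⁻¹ * d ∈ Φ) = Φ.image fun s => d * s⁻¹ := by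
          ext g
          simp only [mem_filter, mem_univ, true_and, mem_image]
          constructor
          · intro hg
            exact ⟨g⁻¹ * d, hg, by group⟩
          · rintro ⟨s, hs, rfl⟩
            simpa using hs
        rw [this, Finset.card_image_of_injective]
        intro x y hxy
        simpa using hxy
    _ = Δ.card * Φ.card := by rw [Finset.sum_const, smul_eq_mul]


/-! ### The pairing with cocharacters and the "μ-table"

Deligne LNM 900 §5 (scan pp. 55–56): the character lattice `X(∏ E^× × 𝔾_m) = ℤ^{S×𝔄} × ℤ` has the
canonical basis `(x_{s,Φ}), x₀`, the dual basis of the cocharacter lattice is `(y_{s,Φ}), y₀`, and the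
Hodge cocharacter is `μ = ∑_{s,Φ} Φ(s) y_{s,Φ} + y₀`.  For ONE CM type `Φ` of a Galois CM field
(`S = G`) the relevant part is `μ_Φ = ∑_{s ∈ Φ} y_s`, i.e. `typeOf Φ` read in the cocharacter lattice
`ℤ[G]`, and the pairing is the standard one `⟨∑ aₛ xₛ, ∑ bₛ yₛ⟩ = ∑ aₛ bₛ`.  The value of the
character `⟨Δ⟩ = ∑_{s ∈ Δ} xₛ` on the Galois translate `g μ_Φ` is `|Δ ∩ g • Φ|` — the entry of the
"μ-table" of `Δ` — and this is also the `g`-coefficient of the wedge character (`pairing_eq_coeff`). -/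

/-- The standard pairing `⟨x, y⟩ = ∑_g x.coeff g * y.coeff g` between the character lattice and the
cocharacter lattice of `T_K`, both identified with `ℤ[G]`. -/
def pairing [Fintype G] (x y : MonoidAlgebra ℤ G) : ℤ := ∑ g : G, x.coeff g * y.coeff g

omit [Group G] in
/-- `⟨typeOf S, typeOf T⟩ = |S ∩ T|`. -/
theorem pairing_typeOf_typeOf [Fintype G] (S T : Finset G) :
    pairing (typeOf S) (typeOf T) = ((S ∩ T).card : ℤ) := by
  unfold pairing
  have h : ∀ g : G, (typeOf S).coeff g * (typeOf T).coeff g = if g ∈ S ∩ T then 1 else 0 := by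
    intro g
    simp only [coeff_typeOf, mem_inter]
    split_ifs <;> simp_all
  simp only [h]
  rw [Finset.sum_ite_mem, Finset.univ_inter, Finset.sum_const]
  simp

/-- The μ-table entry: the character `⟨Δ⟩` evaluated on the Galois translate `g • μ_Φ`. -/
theorem pairing_typeOf_smul [Fintype G] (Δ Φ : Finset G) (g : G) :
    pairing (typeOf Δ) (typeOf (g • Φ)) = ((Δ ∩ g • Φ).card : ℤ) :=
  pairing_typeOf_typeOf Δ (g • Φ)

/-- The μ-table entry equals the `g`-coefficient of the wedge character `typeOf Δ * reflexOf Φ`. -/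
theorem pairing_eq_coeff [Fintype G] (Δ Φ : Finset G) (g : G) :
    pairing (typeOf Δ) (typeOf (g • Φ)) = (typeOf Δ * reflexOf Φ).coeff g := by
  rw [pairing_typeOf_smul, coeff_typeOf_mul_reflexOf]

/-! ### The reflex stabiliser -/

/-- The stabiliser `Stab_G(Φ) = {h | h • Φ = Φ}`: the subgroup of `G` whose fixed field is the reflex
field `K*` of `(K, Φ)`. -/
def reflexStab (Φ : Finset G) : Subgroup G := MulAction.stabilizer G Φ

/-- Membership in the reflex stabiliser: `h • Φ = Φ`. -/
theorem mem_reflexStab {Φ : Finset G} {h : G} : h ∈ reflexStab Φ ↔ h • Φ = Φ :=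
  MulAction.mem_stabilizer_iff

/-- Membership in the reflex stabiliser is decidable. -/
instance (Φ : Finset G) (h : G) : Decidable (h ∈ reflexStab Φ) :=
  decidable_of_iff _ mem_reflexStab.symm

/-- `reflexOf Φ` is invariant under right multiplication by the reflex stabiliser: it descends to
`ℤ[G / Stab_G(Φ)] = ℤ[Hom(K*, ℂ)]`. -/
theorem reflexOf_mul_single_of_mem {Φ : Finset G} {h : G} (hh : h ∈ reflexStab Φ) :
    reflexOf Φ * single h 1 = reflexOf Φ := by
  have hinv : h⁻¹ ∈ reflexStab Φ := (reflexStab Φ).inv_mem hh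
  rw [mem_reflexStab] at hinv
  conv_rhs => rw [← hinv, reflexOf_smul, inv_inv]

/-- `typeOf Φ` is invariant under left multiplication by the reflex stabiliser. -/
theorem single_mul_typeOf_of_mem {Φ : Finset G} {h : G} (hh : h ∈ reflexStab Φ) :
    single h 1 * typeOf Φ = typeOf Φ := by
  rw [mem_reflexStab] at hh
  conv_rhs => rw [← hh, typeOf_smul]

end HodgeRepro.Hecke
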